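import Summits.QuantumFields.BalabanUV.Beta.EriceRemainderEnclosureHistoryAutonomyWellPosed

/-!
# EriceRemainderEnclosureHistoryAutonomyProbe — (E37e) THE ZEROTH-MOMENT CLASS IS STRICTLY LARGER THAN EVERY MEMORY-PROFILE CLASS:
# the functional `u ↦ b + a·sup_j u j` (the coupling-history enters through its SUPREMUM — no decay in the age at all) has zeroth moment
# `a` on every box, floor `b`, and NO `MemoryProfile Cm θ γ` for any `Cm` and any `θ < 1`; by (E37b) its flow with memory is nevertheless
# WELL-POSED on ]0,γ] from every pin as soon as `a·γ < b` — a functional outside node U2's `T4BetaFlowWellPosed.existsUnique_memFlow` for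
# every choice of its constants, inside (E37b)'s `existsUnique_memFlow_zm`

Cell `pub-balaban`, β-function sub-cell, BINDER row D4 «RemainderConst leaves for Bałaban's split» (`HOME/BINDER-OWNERS.md`; owner
lineage `b2b-balaban-beta-an4`; this file by co-owner #2 lineage `b2b-balaban-beta-d4-p2`, generation 39), β-FLOW TEAM duty (1),
FREEZE (0) honoured (def-free: the probe functional is written inline, `fun u ↦ b + a * ⨆ j, u j`; no leaf, no hypothesis shape).
Companion of (E37b) `EriceRemainderEnclosureHistoryAutonomyWellPosed` (imported) and of node U2's `T4BetaFlowWellPosed` §6 `Probes`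
(`affineAvg b a θ` — a functional WITH the geometric profile; here one WITHOUT any).

HONEST FRAMING (page 1, verbatim and binding).  *"Discharging BetaPertH makes Bałaban's UV stability UNCONDITIONAL — a real
constructive-QFT result; it is NOT the continuum limit and NOT the Clay problem."*  THIS FILE DISCHARGES NOTHING OF THE KIND.  A kernel
PROBE (non-vacuity ∕ separation of hypothesis classes) about an explicit toy functional; nothing of Bałaban's (1.22) or of its limit
functional is asserted — which modulus that functional has is NOT PRINTED ([I] p. 298, qualitative).  Row D4 class UNCHANGED
(critical-path width 0; instance 0∕1; D4 DISCHARGE NO DATE).  HONEST DEPENDENCY: continuum YM on T⁴ ⇐ BetaPertH ∧ nine spine estimates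
(0/9 proved); BetaPertH ⇐ (D1) ∧ (D4) ∧ CAP+tail; G-an2-4 gates asym, D1 and NE2/3/4.

THE POINT.  (E37b) replaced node U2's geometric memory profile by the zeroth moment `|B u − B u′| ≤ M·sup_j|u j − u′ j|`.  That this is a
STRICT enlargement, not a re-parametrisation (`zerothMoment_of_memoryProfile` gives profile ⟹ zeroth moment `Cm∕(1−θ)`), is shown by the
supremum functional: §1 zeroth moment `a` (`zerothMoment_sup`), floor `b` (`le_sup_functional`); §2 NO memory profile at any rate `θ < 1`
(`not_memoryProfile_sup`: against the constant history `γ∕2`, raising ONE coupling of age `n` to `γ` moves the functional by `a·γ∕2` while any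
profile allows only `Cm·θⁿ·γ∕2 → 0`); §3 WELL-POSED BY NAME (`existsUnique_memFlow_sup`: (E37b) `existsUnique_memFlow_zm` with `M = a`,
`a·γ < b`).  So at the AUTONOMY row the well-posedness threshold is a statement about the TOTAL sensitivity of the continuum β-functional to
its history, with no reference to how that sensitivity is distributed over the ages.

WHAT IS PROVED ([folklore]; 0 `def`, 0 sorry).  §1 `bddAbove_of_seqBox`, `iSup_le_of_seqBox`, `le_iSup_of_seqBox`, `abs_iSup_sub_iSup_le`,
**`zerothMoment_sup`**, `le_sup_functional`.  §2 **`not_memoryProfile_sup`**.  §3 **`existsUnique_memFlow_sup`**.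
-/

noncomputable section
open Filter Topology Finset

namespace Summit.QuantumFields.BalabanUV.Beta.EriceRemainderEnclosureHistoryAutonomyProbe

open Literature.MathematicalPhysics.QuantumFieldTheory.Balaban1983to89
open Literature.MathematicalPhysics.QuantumFieldTheory.Balaban1983to89.T4BetaStationary
open Literature.MathematicalPhysics.QuantumFieldTheory.Balaban1983to89.T4BetaFlowWellPosed (MemFlow seqBox_const)
open Summit.QuantumFields.BalabanUV.Beta.EriceRemainderEnclosureHistoryAutonomyWellPosed

variable {γ a b : ℝ} {u u' : ℕ → ℝ}

/-! ## §1 The supremum functional has zeroth moment `a` and floor `b` -/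

/-- A box-valued history is bounded above (by `γ`). [folklore] -/
theorem bddAbove_of_seqBox (hu : SeqBox γ u) : BddAbove (Set.range u) :=
  ⟨γ, by rintro _ ⟨j, rfl⟩; exact (hu j).2⟩

/-- `sup_j u j ≤ γ` on the box. [folklore] -/
theorem iSup_le_of_seqBox (hu : SeqBox γ u) : (⨆ j, u j) ≤ γ := ciSup_le fun j => (hu j).2

/-- `u j ≤ sup u` on the box. [folklore] -/
theorem le_iSup_of_seqBox (hu : SeqBox γ u) (j : ℕ) : u j ≤ ⨆ j, u j := le_ciSup (bddAbove_of_seqBox hu) j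

/-- THE SUPREMUM IS 1-LIPSCHITZ IN THE SUPREMUM DISTANCE: entrywise `D`-close box histories have `D`-close suprema. [folklore] -/
theorem abs_iSup_sub_iSup_le (hu : SeqBox γ u) (hu' : SeqBox γ u') {D : ℝ} (hD : ∀ j, |u j - u' j| ≤ D) :
    |(⨆ j, u j) - ⨆ j, u' j| ≤ D := by
  rw [abs_sub_le_iff]
  constructor
  · rw [sub_le_iff_le_add]
    refine ciSup_le fun j => ?_
    have h1 := (abs_sub_le_iff.mp (hD j)).1
    linarith [le_iSup_of_seqBox hu' j]
  · rw [sub_le_iff_le_add]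
    refine ciSup_le fun j => ?_
    have h1 := (abs_sub_le_iff.mp (hD j)).2
    linarith [le_iSup_of_seqBox hu j]

/-- **ZEROTH MOMENT `a`** of `u ↦ b + a·sup_j u j` on every box (`a ≥ 0`): the hypothesis `hB` of (E37b) with `M = a`. [folklore] -/
theorem zerothMoment_sup (ha : 0 ≤ a) :
    ∀ u u' : ℕ → ℝ, SeqBox γ u → SeqBox γ u' → ∀ D : ℝ, (∀ j, |u j - u' j| ≤ D) →
      |(b + a * ⨆ j, u j) - (b + a * ⨆ j, u' j)| ≤ a * D := by
  intro u u' hu hu' D hD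
  rw [show (b + a * ⨆ j, u j) - (b + a * ⨆ j, u' j) = a * ((⨆ j, u j) - ⨆ j, u' j) by ring, abs_mul, abs_of_nonneg ha]
  exact mul_le_mul_of_nonneg_left (abs_iSup_sub_iSup_le hu hu' hD) ha

/-- FLOOR `b` (`a ≥ 0`; the supremum of a box history is positive). [folklore] -/
theorem le_sup_functional (ha : 0 ≤ a) : ∀ u : ℕ → ℝ, SeqBox γ u → b ≤ b + a * ⨆ j, u j := fun _ hu =>
  le_add_of_nonneg_right (mul_nonneg ha ((hu 0).1.le.trans (le_iSup_of_seqBox hu 0)))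

/-! ## §2 … and NO memory profile, at any rate -/

/-- **THE SUPREMUM FUNCTIONAL HAS NO MEMORY PROFILE**: for `a > 0`, `γ > 0`, every `Cm` and every `0 ≤ θ < 1`,
`¬ MemoryProfile Cm θ γ (fun u ↦ b + a·sup_j u j)`.  Witness pair: the constant history `γ∕2` and the same with the coupling of age `n`
raised to `γ`; the functional moves by `a·γ∕2`, the profile bound is `Cm·θⁿ·(γ∕2)`, eventually smaller. [folklore] -/
theorem not_memoryProfile_sup (ha : 0 < a) (hγ : 0 < γ) {Cm θ : ℝ} (hθ0 : 0 ≤ θ) (hθ1 : θ < 1) :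
    ¬ MemoryProfile Cm θ γ (fun u => b + a * ⨆ j, u j) := by
  intro hP
  -- the profile bound tends to zero along the age of the raised coupling
  have ht : Tendsto (fun n : ℕ => Cm * (θ ^ n * (γ / 2))) atTop (𝓝 (Cm * (0 * (γ / 2)))) :=
    ((tendsto_pow_atTop_nhds_zero_of_lt_one hθ0 hθ1).mul_const (γ / 2)).const_mul Cm
  rw [zero_mul, mul_zero] at ht
  obtain ⟨n, hn⟩ := (((tendsto_order.1 ht).2 (a * (γ / 2)) (by positivity)).and (eventually_ge_atTop 0)).exists
  -- the two histories
  set u : ℕ → ℝ := fun _ => γ / 2 with hu_def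
  set u' : ℕ → ℝ := fun j => if j = n then γ else γ / 2 with hu'_def
  have hu : SeqBox γ u := fun _ => ⟨by positivity, by simp only [hu_def]; linarith⟩
  have hu' : SeqBox γ u' := fun j => by
    by_cases hj : j = n
    · simp only [hu'_def, hj, if_true]; exact ⟨hγ, le_rfl⟩
    · simp only [hu'_def, hj, if_false]; exact ⟨by positivity, by linarith⟩
  have hsup : (⨆ j, u j) = γ / 2 := ciSup_const
  have hsup' : (⨆ j, u' j) = γ := by
    refine le_antisymm (iSup_le_of_seqBox hu') ?_
    have := le_iSup_of_seqBox hu' n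
    simp only [hu'_def, if_true] at this
    exact this
  -- the profile side is a single term
  have hvan : ∀ j, j ≠ n → θ ^ j * |u j - u' j| = 0 := fun j hj => by
    simp only [hu_def, hu'_def, hj, if_false, sub_self, abs_zero, mul_zero]
  have htsum : ∑' j, θ ^ j * |u j - u' j| = θ ^ n * (γ / 2) := by
    rw [tsum_eq_single n hvan]
    simp only [hu_def, hu'_def, if_true]
    rw [show γ / 2 - γ = -(γ / 2) by ring, abs_neg, abs_of_pos (by positivity)]
  have h := hP u u' hu hu'
  dsimp only at h
  rw [htsum, hsup, hsup', show (b + a * (γ / 2)) - (b + a * γ) = -(a * (γ / 2)) by ring, abs_neg,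
    abs_of_pos (by positivity)] at h
  linarith [hn.1]

/-! ## §3 … yet its flow with memory is well-posed under `a·γ < b` — BY NAME from (E37b) -/

/-- **WELL-POSEDNESS FOR A FUNCTIONAL WITHOUT ANY MEMORY PROFILE**: for `a ≥ 0`, `b > 0`, a pin `gIR ∈ ]0,γ]` and `a·γ < b`, the flow
`1∕h(m+1)² = 1∕h(m)² + b + a·sup_{j} h(m+1+j)`, `h 0 = gIR`, has EXACTLY ONE box solution ((E37b) `existsUnique_memFlow_zm` with `M = a`).
[folklore] -/
theorem existsUnique_memFlow_sup {gIR : ℝ} (ha : 0 ≤ a) (hb : 0 < b) (hgIR : 0 < gIR) (hgIRγ : gIR ≤ γ) (hsmall : a * γ < b) :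
    ∃! h : ℕ → ℝ, SeqBox γ h ∧ MemFlow (fun u => b + a * ⨆ j, u j) gIR h :=
  existsUnique_memFlow_zm (zerothMoment_sup ha) ha hgIR hgIRγ hb (le_sup_functional ha) hsmall

end Summit.QuantumFields.BalabanUV.Beta.EriceRemainderEnclosureHistoryAutonomyProbe

end
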